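import Literature.Algebra.Homology.ExtOfAcyclicResolutionFunctorialitySquares
import HarnessLib

/-!
# The comparison map `Hⁿ⁺¹(Ext⁰(X, I•)) → Extⁿ⁺¹(X, M)` of an ARBITRARY exact augmented complex,
# and its naturality (no acyclicity)

Topic `Algebra/Homology`; namespace `Literature.Algebra.Homology.AcyclicResolution`.  Sequel of
`ExtOfAcyclicResolution` / `…Naturality` / `…Functoriality(Squares)`; pure homological algebra in an
abelian category with `HasExt`, no named fact, no `sorry`.

Let `X M : C` and `0 → M —η→ I⁰ → I¹ → ⋯` an EXACT augmented cochain complex (`η` mono, `M → I⁰ → I¹`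
exact, `I` exact in positive degrees) — its terms are NOT assumed `Ext(X, –)`-acyclic.  With
`Zⁿ = ker dⁿ` and the short exact sequences `0 → Zⁿ → Iⁿ → Zⁿ⁺¹ → 0`, the iterated connecting maps

  `Ext⁰(X, Zⁿ⁺¹) —δ→ Ext¹(X, Zⁿ) —δ→ Ext²(X, Zⁿ⁻¹) —δ→ ⋯ —δ→ Extⁿ⁺¹(X, Z⁰) ≅ Extⁿ⁺¹(X, M)`

kill the image of `Ext⁰(X, Iⁿ) → Ext⁰(X, Zⁿ⁺¹)` (exactness of `Ext⁰(X, Iⁿ) → Ext⁰(X, Zⁿ⁺¹) → Ext¹(X, Zⁿ)`),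
so they define a homomorphism

  **`homologyToExt : Hⁿ⁺¹(Ext⁰(X, I•)) = ker dⁿ⁺¹_* / Im dⁿ_* →+ Extⁿ⁺¹(X, M)`** (`θ`)

for every exact augmented complex (Weibel §2.4: this is the map whose bijectivity for acyclic terms
is the "acyclic resolutions compute derived functors" statement; Hartshorne III 1.2A).  We prove:

* `homologyToExt_extAddEquivHomologySucc` / `homologyToExt_eq_symm`: when the terms ARE
  `Ext(X, –)`-acyclic, `θ` is the inverse of the engine's `extAddEquivHomologySucc`;
* `homologyToExt_naturality`: `θ` commutes with a cochain map of exact augmented complexes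
  `(φ, g) : (I•, M) → (I'•, M')` (`η ≫ φ⁰ = g ≫ η'`): `θ' ∘ Hⁿ⁺¹(φ_*) = g_* ∘ θ` — NO acyclicity on
  either side;
* `homologyToExt_map`: `θ` commutes with an exact additive functor `F : C ⥤ D`:
  `θ_{F I} ∘ Hⁿ⁺¹(F_*) = F ∘ θ_I` — NO acyclicity on either side.

(Degree `0` needs nothing new: `extAddEquivHomologyZero` and its `_naturality` / `_map` use no
acyclicity.)  Use: the compatibility of the comparison `Extⁿ_{C_Γ}(k, X) ≅ Hⁿ_cont(Γ, X)`
(`DiscreteRepStandardResolution`) with PULLBACK along an arbitrary continuous homomorphism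
`φ : H → Γ` — e.g. `Γ_{K_v} → G_S`, non-injective — where `φ^*` of the standard complex is exact but no
longer acyclic (sequel `DiscreteRepStandardResolutionPullback`; lane «PT-Ш-S-TC» of crux
`stmt-BirchSwinnertonDyer-19032`, input (Λ1)).

## References
* C. A. Weibel, *An introduction to homological algebra*, CUP (1994), §2.4 (dimension shifting,
  Exercise 2.4.3), Theorem 2.7.6. [Weibel1994]
* R. Hartshorne, *Algebraic Geometry*, GTM 52 (1977), III Proposition 1.2A. [Hartshorne1977]
-/

noncomputable section

universe w v v' u u'

namespace Literature.Algebra.Homology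

namespace AcyclicResolution

open CategoryTheory CategoryTheory.Limits CategoryTheory.Abelian

variable {C : Type u} [Category.{v} C] [Abelian C] [HasExt.{w} C]

/-- Unfolding of Mathlib's `Ext.postcomp`. [folklore] -/
private theorem postcomp_apply₃ (X : C) {Y Z : C} {n a b : ℕ} (β : Ext Y Z n) (h : a + n = b)
    (x : Ext X Y a) : β.postcomp X h x = x.comp β h := rfl

/-! ## §1 Iterated connecting homomorphisms (no acyclicity) -/

section Iter

variable (I : CochainComplex C ℕ) (X : C)

/-- **Iterated connecting maps** `Ext^{a+1}(X, Zⁿ) →+ Ext^{a+1+n}(X, Z⁰)` along the short exact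
sequences `0 → Zᵐ → Iᵐ → Zᵐ⁺¹ → 0` of an exact complex (the homomorphism underlying `iterShift`,
defined WITHOUT any acyclicity hypothesis). [cite: Weibel1994, §2.4 (dimension shifting, Exercise 2.4.3)] -/
def iterDelta (hI : ∀ n, I.ExactAt (n + 1)) :
    (n : ℕ) → {a b : ℕ} → (a + 1 + n = b) → (Ext X (I.cycles n) (a + 1) →+ Ext X (I.cycles 0) b)
  | 0, _, _, h => by subst h; exact AddMonoidHom.id _
  | n + 1, a, _, h =>
    (iterDelta hI n (a := a + 1) (by omega)).comp
      ((cyclesSC_shortExact I n (hI n)).extClass.postcomp X (rfl : a + 1 + 1 = a + 1 + 1))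

/-- Unfolding `iterDelta` at `0`. [cite: Weibel1994, §2.4 (dimension shifting, Exercise 2.4.3)] -/
theorem iterDelta_zero_apply (hI : ∀ n, I.ExactAt (n + 1)) {a : ℕ} (x : Ext X (I.cycles 0) (a + 1)) :
    iterDelta I X hI 0 (rfl : a + 1 + 0 = a + 1) x = x := rfl

/-- Unfolding `iterDelta` at `n + 1`: first `δ` along `0 → Zⁿ → Iⁿ → Zⁿ⁺¹ → 0`, then iterate.
[cite: Weibel1994, §2.4 (dimension shifting, Exercise 2.4.3)] -/
theorem iterDelta_succ_apply (hI : ∀ n, I.ExactAt (n + 1)) (n : ℕ) {a b : ℕ} (h : a + 1 + (n + 1) = b)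
    (x : Ext X (I.cycles (n + 1)) (a + 1)) :
    iterDelta I X hI (n + 1) h x =
      iterDelta I X hI n (a := a + 1) (by omega)
        (x.comp (cyclesSC_shortExact I n (hI n)).extClass (rfl : a + 1 + 1 = a + 1 + 1)) := rfl

/-- **In the acyclic case `iterShift` IS `iterDelta`** (as functions).
[cite: Weibel1994, §2.4 (dimension shifting, Exercise 2.4.3)] -/
theorem iterShift_eq_iterDelta (hI : ∀ n, I.ExactAt (n + 1))
    (hX : ∀ n q (e : Ext X (I.X n) (q + 1)), e = 0) :
    ∀ (n : ℕ) {a b : ℕ} (h : a + 1 + n = b) (x : Ext X (I.cycles n) (a + 1)),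
      iterShift I X hI hX n h x = iterDelta I X hI n h x
  | 0, a, b, h, x => by
    subst h
    rfl
  | n + 1, a, b, h, x => by
    rw [iterShift_succ_apply, iterDelta_succ_apply, iterShift_eq_iterDelta hI hX n, shiftAddEquiv_apply]

/-- **Naturality of `iterDelta`** in a cochain map `φ : I ⟶ I'` (through the induced maps on cycles);
no acyclicity. [cite: Weibel1994, §2.4 (dimension shifting, Exercise 2.4.3)] -/
theorem iterDelta_naturality {I' : CochainComplex C ℕ} (φ : I ⟶ I') (hI : ∀ n, I.ExactAt (n + 1))
    (hI' : ∀ n, I'.ExactAt (n + 1)) :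
    ∀ (n : ℕ) {a b : ℕ} (h : a + 1 + n = b) (x : Ext X (I.cycles n) (a + 1)),
      (iterDelta I X hI n h x).comp (Ext.mk₀ (HomologicalComplex.cyclesMap φ 0)) (add_zero b) =
        iterDelta I' X hI' n h (x.comp (Ext.mk₀ (HomologicalComplex.cyclesMap φ n)) (add_zero _))
  | 0, a, b, h, x => by
    subst h
    rw [iterDelta_zero_apply, iterDelta_zero_apply]
  | n + 1, a, b, h, x => by
    rw [iterDelta_succ_apply, iterDelta_succ_apply, iterDelta_naturality φ hI hI' n,
      Ext.comp_assoc_of_third_deg_zero,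
      ShortComplex.ShortExact.extClass_naturality (cyclesSC_shortExact I n (hI n))
        (cyclesSC_shortExact I' n (hI' n)) (cyclesSCMap φ n),
      ← Ext.comp_assoc_of_second_deg_zero]

end Iter

/-! ## §2 `iterDelta` under an exact functor -/

section IterFunctor

variable {D : Type u'} [Category.{v'} D] [Abelian D] [HasExt.{w} D]
  (F : C ⥤ D) [F.Additive] [PreservesFiniteLimits F] [PreservesFiniteColimits F]
  (X : C) (I : CochainComplex C ℕ)

/-- **`F` commutes with `iterDelta`** (up to the cycle isomorphisms `κ : F(Zʲ I) ≅ Zʲ(F I)`); no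
acyclicity. [cite: Weibel1994, Theorem 2.7.6] -/
theorem iterDelta_map (hI : ∀ n, I.ExactAt (n + 1)) :
    ∀ (n : ℕ) {a b : ℕ} (h : a + 1 + n = b) (x : Ext X (I.cycles n) (a + 1)),
      ((iterDelta I X hI n h x).mapExactFunctor F).comp (Ext.mk₀ (cyclesIsoF F I 0).hom) (add_zero b) =
        iterDelta (mapComplex F I) (F.obj X) (map_exactAt F I hI) n h
          ((x.mapExactFunctor F).comp (Ext.mk₀ (cyclesIsoF F I n).hom) (add_zero _))
  | 0, a, b, h, x => by
    subst h
    rw [iterDelta_zero_apply, iterDelta_zero_apply]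
  | n + 1, a, b, h, x => by
    rw [iterDelta_succ_apply, iterDelta_succ_apply, iterDelta_map hI n, Ext.mapExactFunctor_comp,
      mapExactFunctor_extClass_cyclesSC F I n (cyclesSC_shortExact I n (hI n)) (hI n),
      Ext.comp_assoc_of_third_deg_zero,
      extClass_cyclesSCF_comp F I n (hI n) (cyclesSC_shortExact (mapComplex F I) n (map_exactAt F I hI n)),
      ← Ext.comp_assoc_of_second_deg_zero]

end IterFunctor

/-! ## §3 The bottom step `Ext⁰(X, Zⁿ⁺¹) ⧸ Im Ext⁰(X, Iⁿ) → Ext¹(X, Zⁿ)` and the map `θ` -/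

section Theta

variable (X : C) (I : CochainComplex C ℕ) (hI : ∀ n, I.ExactAt (n + 1))

/-- The connecting map `δ : Ext⁰(X, Zⁿ⁺¹) → Ext¹(X, Zⁿ)` kills the image of `Ext⁰(X, Iⁿ)`
(`Ext⁰(X, Iⁿ) → Ext⁰(X, Zⁿ⁺¹) → Ext¹(X, Zⁿ)` is a complex), hence descends to the quotient:
**`Ext⁰(X, Zⁿ⁺¹) ⧸ Im Ext⁰(X, Iⁿ) →+ Ext¹(X, Zⁿ)`** (an isomorphism iff `Ext¹(X, Iⁿ) = 0`, cf.
`extOneQuotientAddEquiv`; defined here unconditionally). [cite: Weibel1994, §2.4 (dimension shifting, Exercise 2.4.3)] -/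
def deltaZeroLift (n : ℕ) :
    Ext X (I.cycles (n + 1)) 0 ⧸ ((Ext.mk₀ (I.toCycles n (n + 1))).postcomp X (add_zero 0)).range →+
      Ext X (I.cycles n) 1 :=
  QuotientAddGroup.lift _ ((cyclesSC_shortExact I n (hI n)).extClass.postcomp X (zero_add 1)) (by
    rintro _ ⟨z, rfl⟩
    rw [AddMonoidHom.mem_ker, postcomp_apply₃, postcomp_apply₃, Ext.comp_assoc_of_second_deg_zero,
      (cyclesSC_shortExact I n (hI n)).comp_extClass, Ext.comp_zero])

/-- Formula: `deltaZeroLift` of the class of `z` is `δ z = z ∘ [0 → Zⁿ → Iⁿ → Zⁿ⁺¹ → 0]`.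
[cite: Weibel1994, §2.4 (dimension shifting, Exercise 2.4.3)] -/
@[simp]
theorem deltaZeroLift_mk (n : ℕ) (z : Ext X (I.cycles (n + 1)) 0) :
    deltaZeroLift X I hI n (QuotientAddGroup.mk z) =
      z.comp (cyclesSC_shortExact I n (hI n)).extClass (zero_add 1) := rfl

/-- In the acyclic case (`Ext¹(X, Iⁿ) = 0`), `deltaZeroLift` inverts `extOneQuotientAddEquiv`.
[cite: Weibel1994, §2.4 (dimension shifting, Exercise 2.4.3)] -/
theorem deltaZeroLift_extOneQuotientAddEquiv (n : ℕ) (h1 : ∀ e : Ext X (I.X n) 1, e = 0)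
    (y : Ext X (I.cycles n) 1) :
    deltaZeroLift X I hI n (extOneQuotientAddEquiv X (cyclesSC_shortExact I n (hI n)) h1 y) = y := by
  obtain ⟨q, hq⟩ := QuotientAddGroup.mk_surjective
    (extOneQuotientAddEquiv X (cyclesSC_shortExact I n (hI n)) h1 y)
  rw [← hq, deltaZeroLift_mk, ← extOneQuotientAddEquiv_symm_mk X (cyclesSC_shortExact I n (hI n)) h1 q,
    hq, AddEquiv.symm_apply_apply]

/-- The concrete description `Hⁿ⁺¹(Ext⁰(X, I•)) ≅ ker dⁿ⁺¹_* ⧸ Im dⁿ_*` used by the engine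
(`homologyIsoSc' ≪≫ abHomologyIso`). [cite: Weibel1994, §2.4 (dimension shifting, Exercise 2.4.3)] -/
abbrev homologySuccIso (n : ℕ) :
    (extComplex X I).homology (n + 1) ≅
      AddCommGrpCat.of (AddMonoidHom.ker ((extComplex X I).sc' n (n + 1) (n + 1 + 1)).g.hom ⧸
        ((extComplex X I).sc' n (n + 1) (n + 1 + 1)).abToCycles.range) :=
  (extComplex X I).homologyIsoSc' n (n + 1) (n + 1 + 1) (CochainComplex.prev_nat_succ n)
      (CochainComplex.next ℕ (n + 1)) ≪≫
    ShortComplex.abHomologyIso _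

/-- The homology class of a "cycle" presented as `z ∈ Ext⁰(X, Zⁿ⁺¹)` (i.e. the class of
`z ∘ ι_{Zⁿ⁺¹} ∈ ker dⁿ⁺¹_*`). [cite: Weibel1994, §2.4 (dimension shifting, Exercise 2.4.3)] -/
def classOf (n : ℕ) (z : Ext X (I.cycles (n + 1)) 0) :
    ((extComplex X I).homology (n + 1) : AddCommGrpCat.{w}) :=
  (homologySuccIso X I n).addCommGroupIsoToAddEquiv.symm
    (QuotientAddGroup.mk (cyclesExtAddEquiv X I n (n + 1) (n + 1 + 1) (CochainComplex.next ℕ (n + 1)) z))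

/-- Every homology class is `classOf z` for some `z ∈ Ext⁰(X, Zⁿ⁺¹)`.
[cite: Weibel1994, §2.4 (dimension shifting, Exercise 2.4.3)] -/
theorem classOf_surjective (n : ℕ) : Function.Surjective (classOf X I n) := fun c => by
  obtain ⟨w, hw⟩ := QuotientAddGroup.mk_surjective ((homologySuccIso X I n).addCommGroupIsoToAddEquiv c)
  refine ⟨(cyclesExtAddEquiv X I n (n + 1) (n + 1 + 1) (CochainComplex.next ℕ (n + 1))).symm w, ?_⟩
  rw [classOf, AddEquiv.apply_symm_apply, hw, AddEquiv.symm_apply_apply]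

variable {M : C} (η : M ⟶ I.X 0) (hη : η ≫ I.d 0 1 = 0) (hex : (ShortComplex.mk η (I.d 0 1) hη).Exact)

/-- **THE COMPARISON MAP `θ : Hⁿ⁺¹(Ext⁰(X, I•)) →+ Extⁿ⁺¹(X, M)` of an exact augmented complex** (no
acyclicity): `ker dⁿ⁺¹_*/Im dⁿ_* ≅ Ext⁰(X, Zⁿ⁺¹)/Im Ext⁰(X, Iⁿ) —δ→ Ext¹(X, Zⁿ) —δ⋯δ→ Extⁿ⁺¹(X, Z⁰) ≅ Extⁿ⁺¹(X, M)`.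
[cite: Weibel1994, §2.4 (dimension shifting, Exercise 2.4.3)][cite: Hartshorne1977, III Proposition 1.2A] -/
def homologyToExt [Mono η] (n : ℕ) :
    ((extComplex X I).homology (n + 1) : AddCommGrpCat.{w}) →+ Ext X M (n + 1) :=
  (extAddEquivOfIso X (isoCyclesZero I η hη hex) (n + 1)).symm.toAddMonoidHom.comp <|
    (iterDelta I X hI n (a := 0) (b := n + 1) (by omega)).comp <|
      (deltaZeroLift X I hI n).comp <|
        (QuotientAddGroup.congr _ _
            (cyclesExtAddEquiv X I n (n + 1) (n + 1 + 1) (CochainComplex.next ℕ (n + 1)))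
            (map_cyclesExtAddEquiv_range X I n)).symm.toAddMonoidHom.comp
          (homologySuccIso X I n).addCommGroupIsoToAddEquiv.toAddMonoidHom

/-- **Formula for `θ` on representatives**: `θ [z ∘ ι] = (transport M ≅ Z⁰)⁻¹ (δ⋯δ (δ z))`.
[cite: Weibel1994, §2.4 (dimension shifting, Exercise 2.4.3)] -/
theorem homologyToExt_classOf [Mono η] (n : ℕ) (z : Ext X (I.cycles (n + 1)) 0) :
    homologyToExt X I hI η hη hex n (classOf X I n z) =
      (extAddEquivOfIso X (isoCyclesZero I η hη hex) (n + 1)).symm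
        (iterDelta I X hI n (a := 0) (b := n + 1) (by omega)
          (z.comp (cyclesSC_shortExact I n (hI n)).extClass (zero_add 1))) := by
  have h1 : (QuotientAddGroup.congr _ _
      (cyclesExtAddEquiv X I n (n + 1) (n + 1 + 1) (CochainComplex.next ℕ (n + 1)))
      (map_cyclesExtAddEquiv_range X I n)).symm
      (QuotientAddGroup.mk
        (cyclesExtAddEquiv X I n (n + 1) (n + 1 + 1) (CochainComplex.next ℕ (n + 1)) z)) =
      QuotientAddGroup.mk z :=
    (AddEquiv.symm_apply_eq _).2 rfl
  change (extAddEquivOfIso X (isoCyclesZero I η hη hex) (n + 1)).symm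
      (iterDelta I X hI n (a := 0) (b := n + 1) (by omega) (deltaZeroLift X I hI n
        ((QuotientAddGroup.congr _ _
          (cyclesExtAddEquiv X I n (n + 1) (n + 1 + 1) (CochainComplex.next ℕ (n + 1)))
          (map_cyclesExtAddEquiv_range X I n)).symm
          ((homologySuccIso X I n).addCommGroupIsoToAddEquiv
            ((homologySuccIso X I n).addCommGroupIsoToAddEquiv.symm (QuotientAddGroup.mk
              (cyclesExtAddEquiv X I n (n + 1) (n + 1 + 1) (CochainComplex.next ℕ (n + 1)) z))))))) = _
  rw [AddEquiv.apply_symm_apply, h1, deltaZeroLift_mk]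

/-! ## §4 Acyclic case: `θ` is the inverse of `extAddEquivHomologySucc` -/

/-- **For `Ext(X, –)`-acyclic terms, `θ ∘ E = id`** where `E = extAddEquivHomologySucc` is the engine's
isomorphism `Extⁿ⁺¹(X, M) ≃+ Hⁿ⁺¹(Ext⁰(X, I•))`. [cite: Weibel1994, §2.4 (dimension shifting, Exercise 2.4.3)] -/
theorem homologyToExt_extAddEquivHomologySucc [Mono η]
    (hX : ∀ n q (e : Ext X (I.X n) (q + 1)), e = 0) (n : ℕ) (x : Ext X M (n + 1)) :
    homologyToExt X I hI η hη hex n (extAddEquivHomologySucc X I η hη hex hI hX n x) = x := by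
  change (extAddEquivOfIso X (isoCyclesZero I η hη hex) (n + 1)).symm
      (iterDelta I X hI n (a := 0) (b := n + 1) (by omega) (deltaZeroLift X I hI n
        ((QuotientAddGroup.congr _ _
          (cyclesExtAddEquiv X I n (n + 1) (n + 1 + 1) (CochainComplex.next ℕ (n + 1)))
          (map_cyclesExtAddEquiv_range X I n)).symm
          ((homologySuccIso X I n).addCommGroupIsoToAddEquiv
            ((homologySuccIso X I n).addCommGroupIsoToAddEquiv.symm
              (QuotientAddGroup.congr _ _
                (cyclesExtAddEquiv X I n (n + 1) (n + 1 + 1) (CochainComplex.next ℕ (n + 1)))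
                (map_cyclesExtAddEquiv_range X I n)
                (extOneQuotientAddEquiv X (cyclesSC_shortExact I n (hI n)) (hX n 0)
                  ((iterShift I X hI hX n (a := 0) (b := n + 1) (by omega)).symm
                    (extAddEquivOfIso X (isoCyclesZero I η hη hex) (n + 1) x))))))))) = x
  rw [AddEquiv.apply_symm_apply, AddEquiv.symm_apply_apply, deltaZeroLift_extOneQuotientAddEquiv,
    ← iterShift_eq_iterDelta I X hI hX n, AddEquiv.apply_symm_apply, AddEquiv.symm_apply_apply]

/-- **Hence `θ = E⁻¹` in the acyclic case.** [cite: Weibel1994, §2.4 (dimension shifting, Exercise 2.4.3)] -/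
theorem homologyToExt_eq_symm [Mono η] (hX : ∀ n q (e : Ext X (I.X n) (q + 1)), e = 0) (n : ℕ)
    (c : ((extComplex X I).homology (n + 1) : AddCommGrpCat.{w})) :
    homologyToExt X I hI η hη hex n c = (extAddEquivHomologySucc X I η hη hex hI hX n).symm c := by
  obtain ⟨x, rfl⟩ := (extAddEquivHomologySucc X I η hη hex hI hX n).surjective c
  rw [homologyToExt_extAddEquivHomologySucc, AddEquiv.symm_apply_apply]

/-- Equivalently `E (θ c) = c` in the acyclic case. [cite: Weibel1994, §2.4 (dimension shifting, Exercise 2.4.3)] -/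
theorem extAddEquivHomologySucc_homologyToExt [Mono η] (hX : ∀ n q (e : Ext X (I.X n) (q + 1)), e = 0)
    (n : ℕ) (c : ((extComplex X I).homology (n + 1) : AddCommGrpCat.{w})) :
    extAddEquivHomologySucc X I η hη hex hI hX n (homologyToExt X I hI η hη hex n c) = c := by
  rw [homologyToExt_eq_symm X I hI η hη hex hX, AddEquiv.apply_symm_apply]

end Theta

/-! ## §5 Naturality of `θ` in the resolution (no acyclicity) -/

section Naturality

variable (X : C) {I I' : CochainComplex C ℕ} (φ : I ⟶ I')
  (hI : ∀ n, I.ExactAt (n + 1)) (hI' : ∀ n, I'.ExactAt (n + 1))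
  {M M' : C} (η : M ⟶ I.X 0) (hη : η ≫ I.d 0 1 = 0) (hex : (ShortComplex.mk η (I.d 0 1) hη).Exact)
  (η' : M' ⟶ I'.X 0) (hη' : η' ≫ I'.d 0 1 = 0) (hex' : (ShortComplex.mk η' (I'.d 0 1) hη').Exact)
  (g : M ⟶ M') (hg : η ≫ φ.f 0 = g ≫ η')

/-- `Hⁿ⁺¹(φ_*)` on representatives: `[z ∘ ι] ↦ [(z ∘ Z(φ)) ∘ ι']`.
[cite: Weibel1994, §2.4 (dimension shifting, Exercise 2.4.3)] -/
theorem homologyMap_classOf (n : ℕ) (z : Ext X (I.cycles (n + 1)) 0) :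
    (HomologicalComplex.homologyMap (extComplexMap X φ) (n + 1)).hom (classOf X I n z) =
      classOf X I' n (z.comp (Ext.mk₀ (HomologicalComplex.cyclesMap φ (n + 1))) (add_zero 0)) := by
  apply (homologySuccIso X I' n).addCommGroupIsoToAddEquiv.injective
  rw [classOf, classOf, AddEquiv.apply_symm_apply]
  change (HomologicalComplex.homologyMap (extComplexMap X φ) (n + 1) ≫ (homologySuccIso X I' n).hom).hom
      ((homologySuccIso X I n).addCommGroupIsoToAddEquiv.symm _) = _
  rw [homologyMap_concrete X φ n (n + 1) (n + 1 + 1) (CochainComplex.prev_nat_succ n)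
    (CochainComplex.next ℕ (n + 1))]
  change kerQuotMap X φ n (n + 1) (n + 1 + 1) ((homologySuccIso X I n).addCommGroupIsoToAddEquiv
      ((homologySuccIso X I n).addCommGroupIsoToAddEquiv.symm _)) = _
  rw [AddEquiv.apply_symm_apply]
  change QuotientAddGroup.mk (kerMap X φ n (n + 1) (n + 1 + 1)
      (cyclesExtAddEquiv X I n (n + 1) (n + 1 + 1) (CochainComplex.next ℕ (n + 1)) z)) =
    QuotientAddGroup.mk _
  congr 1
  apply Subtype.ext
  rw [kerMap_apply_val]
  exact (cyclesExtAddEquiv_naturality X φ n (n + 1) (n + 1 + 1) (CochainComplex.next ℕ (n + 1)) z).symm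

include hg in
/-- **NATURALITY OF `θ` IN THE RESOLUTION.**  For a cochain map `φ : I• → I'•` of exact augmented
complexes over `g : M → M'` (`η ≫ φ⁰ = g ≫ η'`): `θ' (Hⁿ⁺¹(φ_*) c) = (θ c) ∘ g` — with NO acyclicity
hypothesis on `I` or `I'`. [cite: Weibel1994, §2.4 (dimension shifting, Exercise 2.4.3)] -/
theorem homologyToExt_naturality [Mono η] [Mono η'] (n : ℕ)
    (c : ((extComplex X I).homology (n + 1) : AddCommGrpCat.{w})) :
    homologyToExt X I' hI' η' hη' hex' n ((HomologicalComplex.homologyMap (extComplexMap X φ) (n + 1)).hom c) =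
      (homologyToExt X I hI η hη hex n c).comp (Ext.mk₀ g) (add_zero _) := by
  obtain ⟨z, rfl⟩ := classOf_surjective X I n c
  rw [homologyMap_classOf, homologyToExt_classOf, homologyToExt_classOf]
  have ha : (z.comp (Ext.mk₀ (HomologicalComplex.cyclesMap φ (n + 1))) (add_zero 0)).comp
      (cyclesSC_shortExact I' n (hI' n)).extClass (zero_add 1) =
      (z.comp (cyclesSC_shortExact I n (hI n)).extClass (zero_add 1)).comp
        (Ext.mk₀ (HomologicalComplex.cyclesMap φ n)) (add_zero 1) := by
    rw [Ext.comp_assoc_of_second_deg_zero, Ext.comp_assoc_of_third_deg_zero,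
      ShortComplex.ShortExact.extClass_naturality (cyclesSC_shortExact I n (hI n))
        (cyclesSC_shortExact I' n (hI' n)) (cyclesSCMap φ n)]
  rw [ha, ← iterDelta_naturality I X φ hI hI' n]
  apply (extAddEquivOfIso X (isoCyclesZero I' η' hη' hex') (n + 1)).injective
  rw [AddEquiv.apply_symm_apply, ← extAddEquivOfIso_isoCyclesZero_naturality X φ η hη η' hη' g hg hex hex',
    AddEquiv.apply_symm_apply]

end Naturality

/-! ## §6 Naturality of `θ` under an exact functor (no acyclicity) -/

section Functor

variable {D : Type u'} [Category.{v'} D] [Abelian D] [HasExt.{w} D]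
  (F : C ⥤ D) [F.Additive] [PreservesFiniteLimits F] [PreservesFiniteColimits F]
  (X : C) (I : CochainComplex C ℕ) (hI : ∀ n, I.ExactAt (n + 1))
  {M : C} (η : M ⟶ I.X 0) (hη : η ≫ I.d 0 1 = 0) (hex : (ShortComplex.mk η (I.d 0 1) hη).Exact)

attribute [local instance] mono_map_augmentation

/-- `Hⁿ⁺¹(F_*)` on representatives: `[z ∘ ι] ↦ [(F z ∘ κ) ∘ ι_{FI}]`. [cite: Weibel1994, Theorem 2.7.6] -/
theorem homologyMap_extComplexMapF_classOf (n : ℕ) (z : Ext X (I.cycles (n + 1)) 0) :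
    (HomologicalComplex.homologyMap (extComplexMapF F X I) (n + 1)).hom (classOf X I n z) =
      classOf (F.obj X) (mapComplex F I) n
        ((z.mapExactFunctor F).comp (Ext.mk₀ (cyclesIsoF F I (n + 1)).hom) (add_zero 0)) := by
  apply (homologySuccIso (F.obj X) (mapComplex F I) n).addCommGroupIsoToAddEquiv.injective
  rw [classOf, classOf, AddEquiv.apply_symm_apply]
  change (HomologicalComplex.homologyMap (extComplexMapF F X I) (n + 1) ≫
      (homologySuccIso (F.obj X) (mapComplex F I) n).hom).hom
      ((homologySuccIso X I n).addCommGroupIsoToAddEquiv.symm _) = _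
  rw [homologyMap_concreteOf (extComplexMapF F X I) n (n + 1) (n + 1 + 1)
    (CochainComplex.prev_nat_succ n) (CochainComplex.next ℕ (n + 1))]
  change kerQuotMapOf (extComplexMapF F X I) n (n + 1) (n + 1 + 1)
      ((homologySuccIso X I n).addCommGroupIsoToAddEquiv
        ((homologySuccIso X I n).addCommGroupIsoToAddEquiv.symm _)) = _
  rw [AddEquiv.apply_symm_apply]
  change QuotientAddGroup.mk (kerMapOf (extComplexMapF F X I) n (n + 1) (n + 1 + 1)
      (cyclesExtAddEquiv X I n (n + 1) (n + 1 + 1) (CochainComplex.next ℕ (n + 1)) z)) =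
    QuotientAddGroup.mk _
  congr 1
  apply Subtype.ext
  rw [kerMapOf_apply_val, cyclesExtAddEquiv_map]
  rfl

/-- **NATURALITY OF `θ` UNDER AN EXACT FUNCTOR.**  For `F : C ⥤ D` exact additive and an exact
augmented complex `(I•, η)` of `M` (so that `(F I•, F η)` is one of `F M`):
`θ_{F I} (Hⁿ⁺¹(F_*) c) = F (θ_I c)` — with NO acyclicity hypothesis on `I` or `F I`.
[cite: Weibel1994, Theorem 2.7.6] -/
theorem homologyToExt_map [Mono η] [Mono (F.map η)] (n : ℕ)
    (c : ((extComplex X I).homology (n + 1) : AddCommGrpCat.{w})) :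
    homologyToExt (F.obj X) (mapComplex F I) (map_exactAt F I hI) (F.map η) (map_hη F I η hη)
        (map_exact_augmentation F I η hη hex) n
        ((HomologicalComplex.homologyMap (extComplexMapF F X I) (n + 1)).hom c) =
      (homologyToExt X I hI η hη hex n c).mapExactFunctor F := by
  obtain ⟨z, rfl⟩ := classOf_surjective X I n c
  rw [homologyMap_extComplexMapF_classOf, homologyToExt_classOf, homologyToExt_classOf]
  have ha : ((z.mapExactFunctor F).comp (Ext.mk₀ (cyclesIsoF F I (n + 1)).hom) (add_zero 0)).comp
      (cyclesSC_shortExact (mapComplex F I) n (map_exactAt F I hI n)).extClass (zero_add 1) =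
      ((z.comp (cyclesSC_shortExact I n (hI n)).extClass (zero_add 1)).mapExactFunctor F).comp
        (Ext.mk₀ (cyclesIsoF F I n).hom) (add_zero 1) := by
    rw [Ext.mapExactFunctor_comp, mapExactFunctor_extClass_cyclesSC F I n (cyclesSC_shortExact I n (hI n))
      (hI n), Ext.comp_assoc_of_third_deg_zero, extClass_cyclesSCF_comp F I n (hI n)
      (cyclesSC_shortExact (mapComplex F I) n (map_exactAt F I hI n)),
      ← Ext.comp_assoc_of_second_deg_zero]
  rw [ha, ← iterDelta_map F X I hI n]
  apply (extAddEquivOfIso (F.obj X) (isoCyclesZero (mapComplex F I) (F.map η) (map_hη F I η hη)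
    (map_exact_augmentation F I η hη hex)) (n + 1)).injective
  rw [AddEquiv.apply_symm_apply, ← extAddEquivOfIso_isoCyclesZero_map F X I η hη hex,
    AddEquiv.apply_symm_apply]

end Functor

end AcyclicResolution

end Literature.Algebra.Homology
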